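import Summits.QuantumFields.GaugeBoot.TiltedBoxEvenMidAxisRPTwoDimPrep
import HarnessLib

/-!
# The two-layer slab kernel: a free layer between two annuli (gauge-boot, L3 supplement: 2D slab gluing, reduced-half link mirror 1/4)

HONEST FRAMING (cell `pub-gaugeboot`, page 1 of every file): the venture produces certified bounds
on lattice expectations at stated coupling, gauge group, dimension and torus size; NOT a mass gap,
NOT a continuum limit, NOT a string tension; NOT Yang–Mills-summit-bearing (barriers
`FixedCouplingUltralocality`, `PerturbativeInvisibility`). Group-theoretic bookkeeping for the
POSITIVE two-dimensional result `TiltedBoxOddMidAxisRPTwoDim.lean` (reduced-half link reflection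
positivity on the odd square tilted box); it discharges nothing else.

Setting: a compact group `G` with Haar probability measure, a continuous central symmetric weight `ψ`
(in the application `ψ = ω_β^{⋆(2P+1)}`), the slab kernel `k_ψ(α, β) = ∫ (ψ ⋆ ψ)(α x β⁻¹ x⁻¹) dx` of
`SlabKernelGram.lean` (what integrating the rungs of a one-plaquette-thick annulus of two-dimensional
lattice gauge theory leaves of the two boundary holonomies). When the link mirror of the odd square
tilted box is restricted to the REDUCED half `{1 ≤ x_i ≤ P}`, the twisted layer `x_i ≡ P + 1` belongs to
neither half: between the half and its mirror image sit TWO annuli with a FREE layer in between.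
Integrating the free layer's letters composes the two slab kernels over Haar measure:

* `slabKernel₂ ψ α γ = ∫ k_ψ(α, g) k_ψ(γ, g) dg` — the TWO-LAYER KERNEL, defined directly in Gram form
  (feature map `g ↦ k_ψ(α, g)`, real, jointly continuous);
* **`integral_slabKernel_mul_slabKernel`** — the free-letter elimination
  `∫ k_ψ(α, a z b) · k_ψ(a z b, γ) dz = slabKernel₂ ψ α γ` (symmetry `k_ψ(g, γ) = k_ψ(γ, g)` of
  `SlabKernel.slabKernel_symm` and two-sided invariance of Haar measure);
* `slabKernel₂_conj_right` / `_left` — class invariance (the twist of the reflected word is a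
  conjugation, invisible to the kernel);
* **`integral_mul_slabKernel₂_eq`** — the Fubini form of the Gram representation on any finite measure
  space: `∫ Φ · K(a, b) dν = ∫ (∫ Φ · k(a, g) · k(b, g) dν) dg`, whence `slabKernel₂ ψ` is a kernel of
  positive type wherever it is pulled back to (no sign condition on `ψ` or its Fourier coefficients).

All `[folklore]` (Fubini and the invariances of Haar measure; Migdal 1975 gluing in two dimensions).
References: A. A. Migdal, Sov. Phys. JETP 42 (1975) 413; B. K. Driver, Commun. Math. Phys. 123 (1989)
575, §7; C. Berg, J. P. R. Christensen, P. Ressel, *Harmonic Analysis on Semigroups* (1984) Ch. 3 §1.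
-/

noncomputable section

open MeasureTheory Filter Function
open Literature.MathematicalPhysics.QuantumLattice
open Literature.MathematicalPhysics.QuantumFieldTheory (haarProbability)
open Literature.RepresentationTheory.CompactGroups

namespace Summit.QuantumFields.GaugeBoot

namespace SlabKernel

variable {G : Type*} [Group G] [TopologicalSpace G] [IsTopologicalGroup G] [CompactSpace G]
  [MeasurableSpace G] [BorelSpace G]

/-! ## The two-layer kernel -/

/-- **The two-layer kernel** `K_ψ(α, γ) = ∫ k_ψ(α, g) · k_ψ(γ, g) dg`: the composition of two slab
kernels over the Haar-distributed holonomy of a free layer, written directly in Gram form. -/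
def slabKernel₂ (ψ : G → ℝ) (α γ : G) : ℝ :=
  ∫ g, slabKernel ψ α g * slabKernel ψ γ g ∂haarProbability G

/-- The two-layer kernel is symmetric. [folklore] -/
theorem slabKernel₂_symm (ψ : G → ℝ) (α γ : G) : slabKernel₂ ψ α γ = slabKernel₂ ψ γ α :=
  integral_congr_ae (ae_of_all _ fun _ => mul_comm _ _)

/-- Class invariance in the second argument: `K(α, c γ c⁻¹) = K(α, γ)` (central `ψ`). [folklore] -/
theorem slabKernel₂_conj_right {ψ : G → ℝ} (hψ : ∀ g h, ψ (h * g * h⁻¹) = ψ g) (c α γ : G) :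
    slabKernel₂ ψ α (c * γ * c⁻¹) = slabKernel₂ ψ α γ := by
  unfold slabKernel₂
  simp_rw [slabKernel_conj_left hψ]

/-- Class invariance in the first argument: `K(c α c⁻¹, γ) = K(α, γ)` (central `ψ`). [folklore] -/
theorem slabKernel₂_conj_left {ψ : G → ℝ} (hψ : ∀ g h, ψ (h * g * h⁻¹) = ψ g) (c α γ : G) :
    slabKernel₂ ψ (c * α * c⁻¹) γ = slabKernel₂ ψ α γ := by
  unfold slabKernel₂
  simp_rw [slabKernel_conj_left hψ]

/-- The slab kernel is bounded by the sup of `|ψ ⋆ ψ|`. [folklore] -/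
theorem abs_slabKernel_le {ψ : G → ℝ} {C : ℝ} (hC : ∀ g, |haarConv ψ ψ g| ≤ C) (α β : G) :
    |slabKernel ψ α β| ≤ C := by
  unfold slabKernel
  refine (abs_integral_le_integral_abs).trans ?_
  calc ∫ x, |haarConv ψ ψ (α * x * β⁻¹ * x⁻¹)| ∂haarProbability G ≤ ∫ _x, C ∂haarProbability G :=
        integral_mono_of_nonneg (Eventually.of_forall fun _ => abs_nonneg _) (integrable_const C)
          (Eventually.of_forall fun x => hC _)
    _ = C := by simp

/-- A uniform bound for the slab kernel of a continuous weight. [folklore] -/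
theorem exists_abs_slabKernel_le {ψ : G → ℝ} (hψ : Continuous ψ) : ∃ C : ℝ, 0 ≤ C ∧ ∀ α β, |slabKernel ψ α β| ≤ C := by
  have hc : Continuous (haarConv ψ ψ) :=
    continuous_haarConv hψ (hψ.integrable_of_hasCompactSupport (HasCompactSupport.of_compactSpace _))
  obtain ⟨C, hC0, hC⟩ := exists_forall_abs_le_of_continuous hc
  exact ⟨C, hC0, fun α β => abs_slabKernel_le hC α β⟩

variable [SecondCountableTopology G]

/-- The two-layer kernel is jointly continuous. [folklore] -/
theorem continuous_uncurry_slabKernel₂ {ψ : G → ℝ} (hψ : Continuous ψ) : Continuous (uncurry (slabKernel₂ ψ)) := by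
  have hk := continuous_uncurry_slabKernel hψ
  have hF : Continuous (uncurry fun (p : G × G) (g : G) => slabKernel ψ p.1 g * slabKernel ψ p.2 g) :=
    (hk.comp ((continuous_fst.comp continuous_fst).prodMk continuous_snd)).mul
      (hk.comp ((continuous_snd.comp continuous_fst).prodMk continuous_snd))
  exact continuous_integral_of_continuous hF

/-- The two-layer kernel is bounded. [folklore] -/
theorem exists_abs_slabKernel₂_le {ψ : G → ℝ} (hψ : Continuous ψ) : ∃ C : ℝ, 0 ≤ C ∧ ∀ α γ, |slabKernel₂ ψ α γ| ≤ C := by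
  obtain ⟨C, hC⟩ := (isCompact_univ (X := G × G)).exists_bound_of_continuousOn
    (continuous_uncurry_slabKernel₂ hψ).continuousOn
  refine ⟨C, (norm_nonneg _).trans (hC (1, 1) (Set.mem_univ _)), fun α γ => ?_⟩
  have h := hC (α, γ) (Set.mem_univ _)
  rwa [Real.norm_eq_abs] at h

/-! ## Integrating the letters of the free layer -/

/-- **The free-letter elimination.** For `ψ` continuous, central and symmetric,
`∫ k_ψ(α, a z b) · k_ψ(a z b, γ) dz = K_ψ(α, γ)`: the word of the free layer, in which the integrated
letter `z` occurs once, is Haar distributed, and `k_ψ(g, γ) = k_ψ(γ, g)`. [folklore] -/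
theorem integral_slabKernel_mul_slabKernel {ψ : G → ℝ} (hψc : Continuous ψ) (hψ : ∀ g h, ψ (h * g * h⁻¹) = ψ g)
    (hψi : ∀ g, ψ g⁻¹ = ψ g) (α γ a b : G) :
    ∫ z, slabKernel ψ α (a * z * b) * slabKernel ψ (a * z * b) γ ∂haarProbability G = slabKernel₂ ψ α γ := by
  unfold slabKernel₂
  have h1 : ∀ z, slabKernel ψ α (a * z * b) * slabKernel ψ (a * z * b) γ =
      slabKernel ψ α (a * z * b) * slabKernel ψ γ (a * z * b) := fun z => by
    rw [slabKernel_symm hψc hψ hψi (a * z * b) γ]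
  simp_rw [h1]
  have h2 : ∫ z, slabKernel ψ α (a * z * b) * slabKernel ψ γ (a * z * b) ∂haarProbability G =
      ∫ z, slabKernel ψ α (z * b) * slabKernel ψ γ (z * b) ∂haarProbability G :=
    integral_mul_left_eq_self (fun w => slabKernel ψ α (w * b) * slabKernel ψ γ (w * b)) a
  have h3 : ∫ z, slabKernel ψ α (z * b) * slabKernel ψ γ (z * b) ∂haarProbability G =
      ∫ g, slabKernel ψ α g * slabKernel ψ γ g ∂haarProbability G :=
    integral_mul_right_eq_self (fun g => slabKernel ψ α g * slabKernel ψ γ g) b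
  rw [h2, h3]

/-! ## The Gram identity in Fubini form -/

/-- **The two-layer kernel is of positive type on every measure space it is pulled back to** — recorded
as the Fubini form used by the lattice assembly: for a finite measure `ν`, bounded measurable `Φ : Ω → ℂ`
and measurable `a b : Ω → G`,
`∫ Φ(w) K_ψ(a w, b w) dν = ∫ (∫ Φ(w) · k_ψ(a w, g) · k_ψ(b w, g) dν(w)) dg`. [folklore] -/
theorem integral_mul_slabKernel₂_eq {Ω : Type*} [MeasurableSpace Ω] (ν : Measure Ω) [IsFiniteMeasure ν]
    {ψ : G → ℝ} (hψc : Continuous ψ) {Φ : Ω → ℂ} (hΦm : Measurable Φ) {K : ℝ} (hΦb : ∀ w, ‖Φ w‖ ≤ K)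
    {a b : Ω → G} (ha : Measurable a) (hb : Measurable b) :
    ∫ w, Φ w * (slabKernel₂ ψ (a w) (b w) : ℂ) ∂ν =
      ∫ g, ∫ w, Φ w * ((slabKernel ψ (a w) g : ℂ) * (slabKernel ψ (b w) g : ℂ)) ∂ν ∂haarProbability G := by
  obtain ⟨C, hC0, hC⟩ := exists_abs_slabKernel_le hψc
  have hkc := continuous_uncurry_slabKernel hψc
  have hjoint : Continuous fun p : G × G × G => slabKernel ψ p.1 p.2.2 * slabKernel ψ p.2.1 p.2.2 :=
    (hkc.comp (continuous_fst.prodMk (continuous_snd.comp continuous_snd))).mul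
      (hkc.comp ((continuous_fst.comp continuous_snd).prodMk (continuous_snd.comp continuous_snd)))
  have hFm : Measurable fun q : Ω × G => Φ q.1 * ((slabKernel ψ (a q.1) q.2 : ℂ) * (slabKernel ψ (b q.1) q.2 : ℂ)) := by
    refine (hΦm.comp measurable_fst).mul ?_
    have h2 : Measurable fun q : Ω × G => slabKernel ψ (a q.1) q.2 * slabKernel ψ (b q.1) q.2 :=
      hjoint.measurable.comp ((ha.comp measurable_fst).prodMk ((hb.comp measurable_fst).prodMk measurable_snd))
    simpa only [Function.comp_def, Complex.ofReal_mul] using Complex.measurable_ofReal.comp h2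
  have hFb : ∀ q : Ω × G, ‖Φ q.1 * ((slabKernel ψ (a q.1) q.2 : ℂ) * (slabKernel ψ (b q.1) q.2 : ℂ))‖ ≤ K * (C * C) :=
    fun q => by
      rw [norm_mul, norm_mul, Complex.norm_real, Complex.norm_real, Real.norm_eq_abs, Real.norm_eq_abs]
      have hK : 0 ≤ K := (norm_nonneg _).trans (hΦb q.1)
      exact mul_le_mul (hΦb _) (mul_le_mul (hC _ _) (hC _ _) (abs_nonneg _) hC0) (by positivity) hK
  have hint : Integrable (fun q : Ω × G => Φ q.1 * ((slabKernel ψ (a q.1) q.2 : ℂ) * (slabKernel ψ (b q.1) q.2 : ℂ)))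
      (ν.prod (haarProbability G)) :=
    Integrable.of_bound hFm.aestronglyMeasurable (K * (C * C)) (Eventually.of_forall hFb)
  rw [← integral_integral_swap hint]
  refine integral_congr_ae (Eventually.of_forall fun w => ?_)
  dsimp only
  rw [slabKernel₂, ← integral_complex_ofReal, ← integral_const_mul]
  refine integral_congr_ae (Eventually.of_forall fun g => ?_)
  simp only [Complex.ofReal_mul]

end SlabKernel

end Summit.QuantumFields.GaugeBoot

end
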